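import Mathlib

/-!
# STUB-IDEAS k2 g11 — `stub_heegnerIndexLowerAtTwo` (crux `PrintCf2.SplitBadTwoLowerHalfOfFacts`, item 27851)

TECHNIQUE = literature transfer with a typed dictionary.  Node served: **E2** of STUB-PLAN v2.7 row 28
(k3-g10, T1-AT road B): «the Burns–Flach height-one argument (BF06 Prop 5.2) with the unramified
`ℤ₂`-direction `H` adjoined — `Λ' = ℤ₂[G_{N₀2^∞}]⟦H⟧`, the ONE research lemma (XS/S)», plus the page
questions R86 (a)(b).

Dictionary (card §1–§3): the two-variable Coleman sequence at `p = 2` is PRINT + two limit lemmas: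
Greither 1992 Prop 2.10 / Thm 2.4, 2.8 (= Coleman 1979/83 for `𝔾_m` over a finite unramified semilocal
`𝒪`, `p = 2` spelled out) = de Shalit 1987 I.3.7 (13) in the `𝔾_m` case; passing to `lim` along `H`
KILLS the kernel `ℤ₂(1)` (norms square roots of unity: `coherent_roots_trivial`, `coherent_seq_eq_zero`)
and the valuation module (norms double valuations: `valuation_module_dies`), keeps the cokernel `ℤ₂(1)`
(traces compose), and every surviving torsion term (`coker = ℤ₂(r)`, `H²_Iw = ∏_v ℤ₂(r−1)`) has finite
`ℤ₂`-rank over the 3-dimensional `Λ'`, hence is PSEUDO-NULL, hence invisible at every height-one prime: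
BF's criterion [BF06 p.148, Flach Lem 5.7] applies with nothing to cancel (`HeightOneDigits.basis_twoVar`
versus the one-variable pairwise cancellation `basis_oneVar`).  In print at `p ≥ 5` verbatim: Kataoka
2020 (arXiv:2008.02967) Rem 2.7/2.8 + proof of Thm 5.10 («by [de Shalit III.1.3] … i via Coleman power
series … we can ignore the pseudo-null modules Z_𝔭(1)»).

Everything below is Mathlib-only and PROVED (no `sorry`); the number-theoretic objects (`𝒰'`, `Λ'`,
`RΓ(ℚ₂,𝕋')`) are not in the tree, so the lemmas are the *algebraic shadows* the E2 argument consumes,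
stated over abstract groups / `ℤ`, plus two decidable dyadic digits.  Nothing here proves the stub, the
crux `SplitBadTwoLowerHalfOfFacts`, or BSD.
-/

set_option linter.dupNamespace false

namespace Summit.BirchSwinnertonDyer.BirchSwinnertonDyer.Cruxes.SplitBadTwoLowerHalfOfFacts.HeegnerIndexTwo.K2G11

/-! ### §A.  The unramified limit kills the kernel and the valuation module

Along the unramified `ℤ₂`-tower `M_{m+1}/M_m` (degree 2 at each step) the norm acts on `2`-power roots
of unity of the bottom field by SQUARING and on valuations by DOUBLING.  A norm-coherent family is
therefore a `2`-divisibly coherent sequence in a FIXED group; such sequences vanish in any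
`2`-adically separated group (`ℤ₂`, `ℤ`, a finite `2`-group).  Consequences for (21)′:
`ker θ' = lim (ℤ₂(1), ×2) = 0` and `lim (valuation parts) = lim (ℤ₂, ×2) = 0`. -/

/-- Additive form: a sequence with `a m = 2 • a (m+1)` in a `2`-adically separated abelian group is `0`. -/
theorem coherent_seq_eq_zero {M : Type*} [AddCommGroup M] (a : ℕ → M)
    (ha : ∀ m, a m = 2 • a (m + 1))
    (hsep : ∀ x : M, (∀ k : ℕ, ∃ y : M, x = (2 ^ k) • y) → x = 0) :
    ∀ m, a m = 0 := by
  have key : ∀ k m, a m = (2 ^ k) • a (m + k) := by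
    intro k
    induction k with
    | zero => intro m; simp
    | succ k ih =>
      intro m
      rw [ih m, ha (m + k), smul_smul, ← pow_succ, add_assoc]
  intro m
  exact hsep (a m) (fun k => ⟨a (m + k), key k m⟩)

/-- `ℤ` is `2`-adically separated: an integer divisible by every power of `2` is `0`
(shadow of `⋂ₙ 2ⁿℤ₂ = 0`). -/
theorem int_two_adically_separated (x : ℤ) (h : ∀ k : ℕ, ∃ y : ℤ, x = (2 ^ k) • y) : x = 0 := by
  obtain ⟨y, hy⟩ := h x.natAbs
  have hdvd : ((2 : ℤ) ^ x.natAbs) ∣ x := by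
    refine ⟨y, ?_⟩
    rw [nsmul_eq_mul] at hy
    exact_mod_cast hy
  have hnat : 2 ^ x.natAbs ∣ x.natAbs := by
    have h' := Int.natAbs_dvd_natAbs.mpr hdvd
    simpa [Int.natAbs_pow] using h'
  rcases Nat.eq_zero_or_pos x.natAbs with h0 | hpos
  · exact Int.natAbs_eq_zero.mp h0
  · exfalso
    have hle := Nat.le_of_dvd hpos hnat
    exact absurd hle (not_le.mpr Nat.lt_two_pow_self)

/-- **The valuation module dies in two variables** (`ℤ`-shadow of `lim (ℤ₂, ×2) = 0`): a family of
valuations `v m = 2 · v (m+1)` (norm-coherence along the unramified quadratic steps) is identically `0`.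
In BF06's one-variable sequence (20) this module is `∏_{v∣p} ℤ_p(r−1)` and must be cancelled against
`H²`; in two variables it is simply absent. -/
theorem valuation_module_dies (v : ℕ → ℤ) (hv : ∀ m, v m = 2 • v (m + 1)) : ∀ m, v m = 0 :=
  coherent_seq_eq_zero v hv int_two_adically_separated

/-- **No norm-coherent `2`-power roots of unity along `H`** (multiplicative form, fixed finite layer):
in a group of exponent dividing `2^N` (the `2`-power roots of unity of `M_0(μ_{2^n})`, which do NOT grow
along the unramified tower) a squaring-coherent sequence is trivial.  Hence `ker θ' = 0` in (21)′, where
the one-variable (21) has kernel `ℤ₂(1)` (generated by `(−ζ_{2^n})_n` at `p = 2`, Greither Thm 2.8). -/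
theorem coherent_roots_trivial {G : Type*} [Group G] (N : ℕ) (hexp : ∀ g : G, g ^ (2 ^ N) = 1)
    (z : ℕ → G) (hz : ∀ m, z m = (z (m + 1)) ^ 2) : ∀ m, z m = 1 := by
  have key : ∀ k m, z m = (z (m + k)) ^ (2 ^ k) := by
    intro k
    induction k with
    | zero => intro m; simp
    | succ k ih =>
      intro m
      rw [ih m, hz (m + k), ← pow_mul, ← pow_succ', add_assoc]
  intro m
  rw [key N m, hexp]

/-! ### §B.  The height-one ledger: why E2's proof is cancellation-free

BF06 Prop 5.2 proves that the Coleman/Perrin-Riou element `β` generates `Det_Λ⁻¹ RΓ(ℚ_p, 𝕋)` by checking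
every height-one prime `q` of the Cohen–Macaulay semilocal ring `Λ`: there the four torsion modules of
(20)–(21) contribute lengths, and the claim is that the alternating sum vanishes.  One variable (E1):
`ker θ ≅ coker θ ≅ ℤ_p(r)` and `valuation module ≅ H² ≅ ∏ ℤ_p(r−1)` — PAIRWISE cancellation, which at
`p = 2` is where Greither's `{±1}`-modifications of Thm 2.4/2.8 must be tracked.  Two variables (E2):
`ker = 0`, `val = 0` (§A) and `coker θ' = ℤ₂(r)`, `H² = ∏ ℤ₂(r−1)` are pseudo-null over `Λ'`
(finite `ℤ₂`-rank, `dim Λ' = 3`), so ALL FOUR digits are `0` at every height-one `q` — no pairing, no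
regularity of `Λ'_q`, no projective-dimension hypothesis (Det, not Fitt: contrast Kataoka Prop 2.4). -/

/-- Lengths at one height-one prime `q` of the four torsion terms of a Coleman/cohomology sequence. -/
structure HeightOneDigits where
  /-- length of `(ker θ)_q` -/
  ker : ℤ
  /-- length of `(coker θ)_q` -/
  coker : ℤ
  /-- length of the valuation module `(∏ ℤ_p(r−1))_q` inside `H¹` -/
  val : ℤ
  /-- length of `H²_q` -/
  h2 : ℤ
  deriving DecidableEq

namespace HeightOneDigits

/-- The obstruction at `q` to «`β ⊗ 1` is a `Λ_q`-basis of `Det⁻¹ RΓ_q`»: the alternating sum of the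
torsion lengths read off the triangles `[units → H¹ → val]`, `[ker → units → Λ → coker]`, `[H¹, H²]`. -/
def defect (d : HeightOneDigits) : ℤ := (d.coker - d.ker) - (d.h2 - d.val)

/-- E1 (one variable, BF06 Prop 5.2 verbatim): pairwise cancellation. -/
theorem basis_oneVar (d : HeightOneDigits) (hkc : d.ker = d.coker) (hvh : d.val = d.h2) :
    d.defect = 0 := by
  simp only [defect]; omega

/-- E2 (two variables, this card): every digit is zero — two modules are absent (§A), the other two are
pseudo-null, i.e. vanish after localisation at any prime of height `≤ 1`. -/
theorem basis_twoVar (d : HeightOneDigits) (hk : d.ker = 0) (hc : d.coker = 0) (hv : d.val = 0)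
    (hh : d.h2 = 0) : d.defect = 0 := by
  simp only [defect]; omega

/-- What E2 hands to k3-g10's `AnchorLedger`: if the defect vanishes at every height-one prime (a basis
of the invertible `Λ'`-module, Flach Lem 5.7) then after ANY specialisation (E3: `Det` commutes with
`⊗^L`) the index digit `cole N` of the specialised basis is `0` — recorded as the implication shape the
route's ledger consumes (`LatticeGenerated`), with the specialisation step an explicit hypothesis. -/
theorem cole_eq_zero_of_basis {ι : Type*} (defectAt : ι → ℤ) (cole : ℕ → ℤ) (N₀ : ℕ)
    (hbasis : ∀ q, defectAt q = 0)
    (hspec : (∀ q, defectAt q = 0) → ∀ N, N₀ ≤ N → cole N = 0) :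
    ∀ N, N₀ ≤ N → cole N = 0 :=
  hspec hbasis

end HeightOneDigits

/-! ### §C.  Two dyadic digits of the local tower at `v = 𝔭` (numbers, not adjectives)

`K₀ = ℚ(√−7)`, `2 = 𝔭𝔭̄`, `π = (1+√−7)/2 ∈ 𝔭` a uniformiser at `v = 𝔭`, `ππ̄ = 2`.  In `ℤ₂ = K₀,𝔭` the
branch of `√−7` with `π ∈ 2ℤ₂` is `√−7 ≡ 11, 27 (mod 32)`; then `1 + √−7 ≡ 12 (mod 16)` and
`1 − √−7 ≡ 6 (mod 16)`, i.e. `π ≡ 6 (mod 8)`, `π̄ ≡ 3 (mod 8)`, `u₀ := π/2 = π̄⁻¹ ≡ −1 (mod 4)`.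
Consequences quoted by the card: the anomaly index of the `π`-division Lubin–Tate tower over `ℚ₂` is
`N = ord₂(π̄ − 1) = 1` (de Shalit III.1.1 (ii) with `f = 1`, `ξ = π`): the one-variable cokernel
`𝐃/(2^N)(1)` is `𝐃/2`, finite; in two variables `N = ∞` and the cokernel is `𝐃(1)`, torsion-free
pseudo-null — the shape (21)′ asserts. -/

/-- The `𝔭`-adic branch of `√−7` modulo `32` and the two digits `1 ± √−7 (mod 16)`. -/
theorem sqrt_neg_seven_branch :
    ∀ x : ZMod 32, x ^ 2 = -7 → x.val % 4 = 3 → (x + 1).val % 16 = 12 ∧ (1 - x).val % 16 = 6 := by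
  decide

/-- All square roots of `−7` modulo `32` (both branches). -/
theorem sqrt_neg_seven_all : ∀ x : ZMod 32, x ^ 2 = -7 → (x = 5 ∨ x = 11 ∨ x = 21 ∨ x = 27) := by
  decide

/-- `π̄ ≡ 3 (mod 8)` gives `ord₂(π̄ − 1) = 1` exactly: the anomaly index is `N = 1`
(no `μ₄` in the `π`-division tower of `ℚ₂`). -/
theorem anomaly_index_one (t : ℤ) (ht : t % 8 = 3) : 2 ∣ (t - 1) ∧ ¬ 4 ∣ (t - 1) := by
  omega

end Summit.BirchSwinnertonDyer.BirchSwinnertonDyer.Cruxes.SplitBadTwoLowerHalfOfFacts.HeegnerIndexTwo.K2G11
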